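import Mathlib
import HarnessLib
import Summits.HubbardSuperconductivity.HubbardSuperconductivity.Theorems.KLProgrammeKLRegimeVolumeLimitTwoPointFourier
import Summits.HubbardSuperconductivity.HubbardSuperconductivity.Theorems.KLProgrammeThermalGreenMatsubaraWordL1

/-!
# Per-label `M → ∞` limits of the BARE VL carrier from the time-resolved two-point limit — the hypothesis `h2` of
# `stub_vl_bound_of_Z1_twoPoint` modulo the Hamiltonian identification (seat hubbard-kl-k3c5-p2, g3)

Route `KLProgramme`, gen-4 child 5 `KLRegimeVolumeLimitV12` (stmt-HubbardSuperconductivity-19858), stub `stub_vl_bound`.  Fix `L ≥ 3`,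
`β > 0`, real `U, μ`, a spin `σ`, a Matsubara INTEGER `n` and a torus momentum `p`.  Suppose the position two-point word
`W_M(x,y,u) = ∫dμ_{C_M} ψ⁺_{(x,u)σ}ψ⁻_{(y,0)σ}e^{−V}` converges for every pair of sites and every `u ∈ (0,β)` to some `Nl x y u`
(k3c5-p1's (H1) supplies this with `Nl` = the Hamiltonian two-time trace; here `Nl` is abstract).  Then:

* `tendsto_integral_norm_sub_twoPointRatio` — `∫_{[0,β]} ‖W_M(x,y,u)/D_M − Nl x y u/D∞‖ du → 0` (k3c4-p2's `…MatsubaraWordL1` for the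
  `1+1` word, the value at `u = 0` patched by t2's equal-time limit; `D∞ = e^{−βUL²/4} Z_{H'}/Z_{H₀}`);
* `intervalIntegrable_twoPointLimit` — `u ↦ Nl x y u` is integrable on `[0,β]` (a.e. limit of uniformly bounded continuous functions);
* **`tendsto_twoPointTransform`** — with the kernel `K(z,y,u) = e^{−ik₀u} conj χ_p(z) χ_p(y)`, `k₀ = (2n+1)π/β`:
  `∫₀^β Σ_{z,y} K·W_M/D_M du → ∫₀^β Σ_{z,y} K·Nl/D∞ du`;
* `genPairRatio_eq_transform` — at every cutoff `M` and every kept index `ω` with `matsubaraInt M ω = n`: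
  `N_M((ω,p),σ)/D_M = β·∫₀^β Σ_{z,y} K·W_M/D_M du` (`genPair_eq_integral_twoPointWord_two`; the frequency of `ω` IS `k₀`);
* **`twoPointLabelLimit_of_timeLimit`** — the `h2`-shaped conclusion: with
  `σ∞ = (β·I∞ + βL²ĝ)/(βL²ĝ²)`, `I∞ = ∫₀^β Σ_{z,y} K·Nl/D∞ du`, `ĝ = 1/(−ik₀ + ε(p) − μ)`,
  `∀ ε > 0, ∃ M₁, ∀ M ≥ M₁, ∀ ω, matsubaraInt M ω = n → ‖klSelfEnergy L M β U μ 0 klE0 (nScales β + 1) (ω, p) σ − σ∞‖ ≤ ε`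
  (g0's frame reduction `klSelfEnergy_nScales_succ_frame_reduction` at the bare frame + `D_M → D∞ ≠ 0`).

The identification of `I∞` with `−L²·𝒢_L(k₀, −p)` (Hamiltonian Matsubara Green function at `μ + U/2`) and the `L`-uniform bound
`‖σ∞‖ ≤ BH(β,U)` (k3c5-p2 g2 `norm_reamputated_matsubaraGreen_frame_le_fermi`) are the next file.  Everything is proved; no definition.
-/

noncomputable section

namespace Summit.HubbardSuperconductivity.HubbardSuperconductivity.Theorems.TwoPointAssembly

set_option linter.dupNamespace false -- summit = problem name (single-conjunct summit), D-0017

open Finset Filter Topology MeasureTheory intervalIntegral Literature.MathematicalPhysics.QuantumLattice Literature.Probability.LatticeModels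
  GrassmannAlgebra
open Summit.HubbardSuperconductivity.HubbardSuperconductivity.Theorems.MatsubaraAllU
open Summit.HubbardSuperconductivity.HubbardSuperconductivity.Theorems.KLRegimeSplit
open Summit.HubbardSuperconductivity.HubbardSuperconductivity.Theorems.KLProgrammeLegKernels
open scoped ComplexConjugate ComplexOrder

variable {L : ℕ} [NeZero L]

/-! ## §1 The `1+1` word in k3c4-p2's word format; the bare partition-function limit -/

/-- The two-point word `ψ⁺_{(x,s₀)σ}ψ⁻_{(y,s₁)σ}·E` in the word format of `…ThermalGreenMatsubaraWord*` (two point slots, one pair). -/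
theorem wordFormat_twoPoint {M : ℕ} (β : ℝ) (σ : Fin 2) (x y : TorusSite 2 L) (s : Fin 2 → ℝ) (E : HubbardGrassmann L M) :
    (List.ofFn fun l : Fin 1 =>
        positionField L M β 0 ((fun _ : Fin 1 => ((0 : Fin 2), σ)) l).2
            ((![x, y] : Fin 2 → TorusSite 2 L) ((fun _ : Fin 1 => ((0 : Fin 2), σ)) l).1) (s ((fun _ : Fin 1 => ((0 : Fin 2), σ)) l).1) *
          positionField L M β 1 ((fun _ : Fin 1 => ((1 : Fin 2), σ)) l).2
            ((![x, y] : Fin 2 → TorusSite 2 L) ((fun _ : Fin 1 => ((1 : Fin 2), σ)) l).1) (s ((fun _ : Fin 1 => ((1 : Fin 2), σ)) l).1)).prod * E =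
      positionField L M β 0 σ x (s 0) * positionField L M β 1 σ y (s 1) * E := by
  simp [List.ofFn_succ]

omit [NeZero L] in
/-- The limit `D∞ = e^{−βUL²/4}·Z_{H'}/Z_{H₀}` of the bare normalised partition functions is non-zero. -/
theorem partitionLimit_ne_zero (β U μ : ℝ) :
    ((Real.exp (-(β * U / 4 * (L : ℝ) ^ 2)) : ℂ) * Matrix.partitionFn β (hubbardTorusWith 2 L 1 U (μ + U / 2)) /
        Matrix.partitionFn β (hubbardTorusWith 2 L 1 0 μ)) ≠ 0 := by
  haveI : Nonempty (Finset (Orb (FermionTorus 2 L))) := ⟨∅⟩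
  have hZ' : Matrix.partitionFn β (hubbardTorusWith 2 L 1 U (μ + U / 2)) ≠ 0 :=
    (Matrix.partitionFn_pos β (isHermitian_hamiltonianWith (fermionTorusGraph 2 L) 1 U (μ + U / 2))).ne'
  have hZ₀ : Matrix.partitionFn β (hubbardTorusWith 2 L 1 0 μ) ≠ 0 :=
    (Matrix.partitionFn_pos β (isHermitian_hamiltonianWith (fermionTorusGraph 2 L) 1 0 μ)).ne'
  have he : ((Real.exp (-(β * U / 4 * (L : ℝ) ^ 2)) : ℝ) : ℂ) ≠ 0 := by exact_mod_cast (Real.exp_pos _).ne'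
  exact div_ne_zero (mul_ne_zero he hZ') hZ₀

/-- Eventually in `M` the bare normalised partition function does not vanish. -/
theorem eventually_effPartitionFn_ne_zero (hL : 3 ≤ L) {β : ℝ} (hβ : 0 < β) (U μ : ℝ) :
    ∀ᶠ M : ℕ in atTop, effPartitionFn ℂ (hubbardCovariance L M β μ 0) (hubbardInteraction L M β U) ≠ 0 :=
  (tendsto_effPartitionFn_hubbard_eq_partitionFn_div_allU hL hβ μ U).eventually_ne (partitionLimit_ne_zero β U μ)

/-! ## §2 `L¹(du)` convergence of the normalised two-point word and integrability of its limit -/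

/-- **`L¹([0,β])` convergence of the normalised two-point word** (every `U`, `L ≥ 3`): if `W_M(x,y,u) → Nl u` for every
`u ∈ (0,β)`, then `∫_{[0,β]} ‖W_M(x,y,u)/D_M − Nl u/D∞‖ du → 0`. -/
theorem tendsto_integral_norm_sub_twoPointRatio (hL : 3 ≤ L) {β : ℝ} (hβ : 0 < β) (U μ : ℝ) (σ : Fin 2) (x y : TorusSite 2 L)
    {Nl : ℝ → ℂ}
    (hNl : ∀ u ∈ Set.Ioo (0 : ℝ) β, Tendsto (fun M : ℕ => gaussExpect ℂ (hubbardCovariance L M β μ 0)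
        (positionField L M β 0 σ x u * positionField L M β 1 σ y 0 * grassmannExp (-(hubbardInteraction L M β U))))
      atTop (𝓝 (Nl u))) :
    Tendsto (fun M : ℕ => ∫ u in Set.Icc (0 : ℝ) β, ‖gaussExpect ℂ (hubbardCovariance L M β μ 0)
        (positionField L M β 0 σ x u * positionField L M β 1 σ y 0 * grassmannExp (-(hubbardInteraction L M β U))) /
          effPartitionFn ℂ (hubbardCovariance L M β μ 0) (hubbardInteraction L M β U) -
        Nl u / ((Real.exp (-(β * U / 4 * (L : ℝ) ^ 2)) : ℂ) * Matrix.partitionFn β (hubbardTorusWith 2 L 1 U (μ + U / 2)) /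
            Matrix.partitionFn β (hubbardTorusWith 2 L 1 0 μ))‖) atTop (𝓝 0) := by
  -- the value at `u = 0` is patched by the equal-time limit (a null set for the integral)
  set W : ℕ → ℝ → ℂ := fun M u => gaussExpect ℂ (hubbardCovariance L M β μ 0)
    (positionField L M β 0 σ x u * positionField L M β 1 σ y 0 * grassmannExp (-(hubbardInteraction L M β U))) with hW
  have h0 : Tendsto (fun M : ℕ => W M 0) atTop (𝓝 (limUnder atTop fun M : ℕ => W M 0)) :=
    tendsto_nhds_limUnder ⟨_, tendsto_gaussExpect_twoPoint_eq_trace_div_allU hL hβ μ U σ σ x y⟩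
  set Nl' : ℝ → ℂ := fun u => if u = 0 then limUnder atTop (fun M : ℕ => W M 0) else Nl u with hNl'
  have hNl'0 : ∀ u ∈ Set.Ico (0 : ℝ) β, Tendsto (fun M : ℕ => W M u) atTop (𝓝 (Nl' u)) := by
    intro u hu
    by_cases hu0 : u = 0
    · subst hu0; simp only [hNl', if_true]; exact h0
    · simp only [hNl', hu0, if_false]
      exact hNl u ⟨lt_of_le_of_ne hu.1 (Ne.symm hu0), hu.2⟩
  -- k3c4-p2's `L¹` lemma for the `1+1` word (two point slots, one pair, times `(u, 0)`)
  have hsc : Continuous fun u : ℝ => (![u, 0] : Fin 2 → ℝ) := by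
    refine continuous_pi fun i => ?_
    fin_cases i
    · exact continuous_id
    · exact continuous_const
  have hscI : ∀ u ∈ Set.Ico (0 : ℝ) β, ∀ q : Fin 2, (![u, 0] : Fin 2 → ℝ) q ∈ Set.Ico (0 : ℝ) β := by
    intro u hu q
    fin_cases q
    · exact hu
    · exact ⟨le_rfl, hβ⟩
  have hPe : Function.Injective (fun _ : Fin 1 => ((0 : Fin 2), σ)) := Function.injective_of_subsingleton _
  have hQe : Function.Injective (fun _ : Fin 1 => ((1 : Fin 2), σ)) := Function.injective_of_subsingleton _
  have hNl'w : ∀ u ∈ Set.Ico (0 : ℝ) β, Tendsto (fun M : ℕ => gaussExpect ℂ (hubbardCovariance L M β μ 0)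
      ((List.ofFn fun l : Fin 1 =>
        positionField L M β 0 ((fun _ : Fin 1 => ((0 : Fin 2), σ)) l).2
            ((![x, y] : Fin 2 → TorusSite 2 L) ((fun _ : Fin 1 => ((0 : Fin 2), σ)) l).1)
            ((![u, 0] : Fin 2 → ℝ) ((fun _ : Fin 1 => ((0 : Fin 2), σ)) l).1) *
          positionField L M β 1 ((fun _ : Fin 1 => ((1 : Fin 2), σ)) l).2
            ((![x, y] : Fin 2 → TorusSite 2 L) ((fun _ : Fin 1 => ((1 : Fin 2), σ)) l).1)
            ((![u, 0] : Fin 2 → ℝ) ((fun _ : Fin 1 => ((1 : Fin 2), σ)) l).1)).prod *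
        grassmannExp (-(hubbardInteraction L M β U)))) atTop (𝓝 (Nl' u)) := by
    intro u hu
    simp_rw [wordFormat_twoPoint]
    simpa only [Matrix.cons_val_zero, Matrix.cons_val_one, Matrix.head_cons] using hNl'0 u hu
  have hmain := tendsto_integral_norm_sub_wordRatio_effPartitionFn_allU hL hβ μ U (k := 2) (m := 1)
    (![x, y] : Fin 2 → TorusSite 2 L) (fun _ : Fin 1 => ((0 : Fin 2), σ)) (fun _ : Fin 1 => ((1 : Fin 2), σ)) hPe hQe hsc hscI hNl'w
  simp_rw [wordFormat_twoPoint] at hmain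
  simp only [Matrix.cons_val_zero, Matrix.cons_val_one] at hmain
  -- replace `Nl'` by `Nl` under the integral (they differ only at `u = 0`)
  have hae : ∀ᵐ u ∂(volume.restrict (Set.Icc (0 : ℝ) β)), u ≠ 0 := by
    have h : ∀ᵐ u ∂(volume : Measure ℝ), u ∉ ({0} : Set ℝ) := measure_eq_zero_iff_ae_notMem.1 Real.volume_singleton
    exact ae_restrict_of_ae (h.mono fun u hu => fun h0 => hu (Set.mem_singleton_iff.2 h0))
  refine hmain.congr' (Eventually.of_forall fun M => integral_congr_ae ?_)
  filter_upwards [hae] with u hu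
  simp only [hNl', hu, if_false, hW]

/-- **The time-resolved limit is integrable on `[0,β]`**: an a.e. limit of the continuous, eventually uniformly bounded functions
`u ↦ W_M(x,y,u)`. -/
theorem intervalIntegrable_twoPointLimit {β : ℝ} (hβ : 0 < β) (U μ : ℝ) (σ : Fin 2) (x y : TorusSite 2 L) {Nl : ℝ → ℂ}
    (hNl : ∀ u ∈ Set.Ioo (0 : ℝ) β, Tendsto (fun M : ℕ => gaussExpect ℂ (hubbardCovariance L M β μ 0)
        (positionField L M β 0 σ x u * positionField L M β 1 σ y 0 * grassmannExp (-(hubbardInteraction L M β U))))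
      atTop (𝓝 (Nl u))) :
    IntervalIntegrable Nl volume 0 β := by
  set W : ℕ → ℝ → ℂ := fun M u => gaussExpect ℂ (hubbardCovariance L M β μ 0)
    (positionField L M β 0 σ x u * positionField L M β 1 σ y 0 * grassmannExp (-(hubbardInteraction L M β U))) with hW
  -- the uniform bound (k3c4-p2), in the word format
  have hPe : Function.Injective (fun _ : Fin 1 => ((0 : Fin 2), σ)) := Function.injective_of_subsingleton _
  have hQe : Function.Injective (fun _ : Fin 1 => ((1 : Fin 2), σ)) := Function.injective_of_subsingleton _
  obtain ⟨C, hC0, M₀, hMC⟩ := exists_uniform_bound_gaussExpect_word_allU (L := L) hβ μ U (k := 2) (m := 1)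
    (![x, y] : Fin 2 → TorusSite 2 L) (fun _ : Fin 1 => ((0 : Fin 2), σ)) (fun _ : Fin 1 => ((1 : Fin 2), σ)) hPe hQe
  have hbound : ∀ M, M₀ ≤ M → ∀ u ∈ Set.Icc (0 : ℝ) β, ‖W M u‖ ≤ C := by
    intro M hM u hu
    have h := hMC M hM (![u, 0] : Fin 2 → ℝ) (fun q => by
      fin_cases q
      · exact hu
      · exact ⟨le_rfl, hβ.le⟩)
    rw [wordFormat_twoPoint] at h
    simpa only [Matrix.cons_val_zero, Matrix.cons_val_one, Matrix.head_cons, hW] using h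
  -- a.e. convergence on `(0, β]` (only `u = β` is excluded from `(0, β)`, a null set)
  rw [intervalIntegrable_iff_integrableOn_Ioc_of_le hβ.le]
  have hae : ∀ᵐ u ∂(volume.restrict (Set.Ioc (0 : ℝ) β)), u ∈ Set.Ioo (0 : ℝ) β := by
    rw [ae_restrict_iff' measurableSet_Ioc]
    have h : ∀ᵐ u ∂(volume : Measure ℝ), u ∉ ({β} : Set ℝ) := measure_eq_zero_iff_ae_notMem.1 Real.volume_singleton
    filter_upwards [h] with u hu huI
    exact ⟨huI.1, lt_of_le_of_ne huI.2 fun h => hu (Set.mem_singleton_iff.2 h)⟩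
  have hmeas : ∀ M : ℕ, AEStronglyMeasurable (W M) (volume.restrict (Set.Ioc (0 : ℝ) β)) := fun M =>
    (continuous_twoPointWord (L := L) (M := M) β U μ σ x y).aestronglyMeasurable
  have hlim : ∀ᵐ u ∂(volume.restrict (Set.Ioc (0 : ℝ) β)), Tendsto (fun M : ℕ => W M u) atTop (𝓝 (Nl u)) := by
    filter_upwards [hae] with u hu using hNl u hu
  have hNlmeas : AEStronglyMeasurable Nl (volume.restrict (Set.Ioc (0 : ℝ) β)) :=
    aestronglyMeasurable_of_tendsto_ae atTop hmeas hlim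
  have hNlC : ∀ᵐ u ∂(volume.restrict (Set.Ioc (0 : ℝ) β)), ‖Nl u‖ ≤ C := by
    filter_upwards [hae] with u hu
    refine le_of_tendsto (hNl u hu).norm ?_
    filter_upwards [eventually_ge_atTop M₀] with M hM
    exact hbound M hM u (Set.Ioo_subset_Icc_self hu)
  exact IntegrableOn.of_bound measure_Ioc_lt_top hNlmeas C hNlC

/-! ## §3 The limit of the Fourier transform at a fixed Matsubara integer -/

/-- **THE TRANSFORM LIMIT at a fixed Matsubara integer `n` and momentum `p`** (every `U`, `L ≥ 3`): with
`K(z,y,u) = e^{−ik₀u} conj χ_p(z) χ_p(y)`, `k₀ = (2n+1)π/β`, `∫₀^β Σ_{z,y} K·W_M(z,y,u)/D_M du → ∫₀^β Σ_{z,y} K·Nl z y u/D∞ du`. -/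
theorem tendsto_twoPointTransform (hL : 3 ≤ L) {β : ℝ} (hβ : 0 < β) (U μ : ℝ) (σ : Fin 2) (n : ℤ) (p : TorusSite 2 L)
    {Nl : TorusSite 2 L → TorusSite 2 L → ℝ → ℂ}
    (hNl : ∀ (x y : TorusSite 2 L), ∀ u ∈ Set.Ioo (0 : ℝ) β, Tendsto (fun M : ℕ => gaussExpect ℂ (hubbardCovariance L M β μ 0)
        (positionField L M β 0 σ x u * positionField L M β 1 σ y 0 * grassmannExp (-(hubbardInteraction L M β U))))
      atTop (𝓝 (Nl x y u))) :
    Tendsto (fun M : ℕ => ∫ u in (0 : ℝ)..β, ∑ z : TorusSite 2 L, ∑ y : TorusSite 2 L,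
        Complex.exp (-(((fermiMatsubara β n * u : ℝ) : ℂ) * Complex.I)) * conj (torusChar p z) * torusChar p y *
          (gaussExpect ℂ (hubbardCovariance L M β μ 0)
              (positionField L M β 0 σ z u * positionField L M β 1 σ y 0 * grassmannExp (-(hubbardInteraction L M β U))) /
            effPartitionFn ℂ (hubbardCovariance L M β μ 0) (hubbardInteraction L M β U))) atTop
      (𝓝 (∫ u in (0 : ℝ)..β, ∑ z : TorusSite 2 L, ∑ y : TorusSite 2 L,
        Complex.exp (-(((fermiMatsubara β n * u : ℝ) : ℂ) * Complex.I)) * conj (torusChar p z) * torusChar p y *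
          (Nl z y u / ((Real.exp (-(β * U / 4 * (L : ℝ) ^ 2)) : ℂ) * Matrix.partitionFn β (hubbardTorusWith 2 L 1 U (μ + U / 2)) /
            Matrix.partitionFn β (hubbardTorusWith 2 L 1 0 μ))))) := by
  -- opaque names for the limit of the partition functions, the partition functions, the words and the kernel
  obtain ⟨Dinf, hDinf⟩ : ∃ Dinf : ℂ, Dinf = ((Real.exp (-(β * U / 4 * (L : ℝ) ^ 2)) : ℂ) *
      Matrix.partitionFn β (hubbardTorusWith 2 L 1 U (μ + U / 2)) / Matrix.partitionFn β (hubbardTorusWith 2 L 1 0 μ)) := ⟨_, rfl⟩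
  obtain ⟨D, hD⟩ : ∃ D : ℕ → ℂ, ∀ M, D M = effPartitionFn ℂ (hubbardCovariance L M β μ 0) (hubbardInteraction L M β U) :=
    ⟨_, fun _ => rfl⟩
  obtain ⟨W, hW⟩ : ∃ W : ℕ → TorusSite 2 L → TorusSite 2 L → ℝ → ℂ, ∀ M z y u, W M z y u = gaussExpect ℂ (hubbardCovariance L M β μ 0)
      (positionField L M β 0 σ z u * positionField L M β 1 σ y 0 * grassmannExp (-(hubbardInteraction L M β U))) :=
    ⟨_, fun _ _ _ _ => rfl⟩
  obtain ⟨K, hK⟩ : ∃ K : TorusSite 2 L → TorusSite 2 L → ℝ → ℂ, ∀ z y u, K z y u =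
      Complex.exp (-(((fermiMatsubara β n * u : ℝ) : ℂ) * Complex.I)) * conj (torusChar p z) * torusChar p y := ⟨_, fun _ _ _ => rfl⟩
  simp only [← hDinf, ← hD, ← hW, ← hK]
  have hKnorm : ∀ z y u, ‖K z y u‖ = 1 := fun z y u => by
    rw [hK, norm_mul, norm_mul, ← neg_mul, ← Complex.ofReal_neg, Complex.norm_exp_ofReal_mul_I, Complex.norm_conj, norm_torusChar,
      norm_torusChar, one_mul, one_mul]
  have hKcont : ∀ z y, Continuous (K z y) := fun z y => by
    have h : K z y = fun u => Complex.exp (-(((fermiMatsubara β n * u : ℝ) : ℂ) * Complex.I)) * conj (torusChar p z) * torusChar p y :=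
      funext fun u => hK z y u
    rw [h]; fun_prop
  have hWc : ∀ M z y, Continuous (W M z y) := fun M z y => by
    have h : W M z y = fun u => gaussExpect ℂ (hubbardCovariance L M β μ 0)
        (positionField L M β 0 σ z u * positionField L M β 1 σ y 0 * grassmannExp (-(hubbardInteraction L M β U))) :=
      funext fun u => hW M z y u
    rw [h]; exact continuous_twoPointWord (L := L) (M := M) β U μ σ z y
  have hNlW : ∀ z y, ∀ u ∈ Set.Ioo (0 : ℝ) β, Tendsto (fun M : ℕ => W M z y u) atTop (𝓝 (Nl z y u)) := by
    intro z y u hu; simp only [hW]; exact hNl z y u hu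
  -- the differences `d_M(z,y,u) = W_M/D_M − Nl/D∞` and their `L¹` convergence (k3c4-p2 + §2)
  obtain ⟨d, hd⟩ : ∃ d : ℕ → TorusSite 2 L → TorusSite 2 L → ℝ → ℂ, ∀ M z y u, d M z y u = W M z y u / D M - Nl z y u / Dinf :=
    ⟨_, fun _ _ _ _ => rfl⟩
  have hdL1 : ∀ z y, Tendsto (fun M : ℕ => ∫ u in Set.Icc (0 : ℝ) β, ‖d M z y u‖) atTop (𝓝 0) := fun z y => by
    have h := tendsto_integral_norm_sub_twoPointRatio hL hβ U μ σ z y (hNl z y)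
    simp only [← hDinf, ← hD, ← hW, ← hd] at h
    exact h
  -- integrability
  have hNli : ∀ z y, IntervalIntegrable (Nl z y) volume 0 β := fun z y => intervalIntegrable_twoPointLimit hβ U μ σ z y (hNl z y)
  have hfi : ∀ M z y, IntervalIntegrable (fun u => K z y u * (W M z y u / D M)) volume 0 β := fun M z y =>
    ((hKcont z y).mul ((hWc M z y).div_const _)).intervalIntegrable _ _
  have hgi : ∀ z y, IntervalIntegrable (fun u => K z y u * (Nl z y u / Dinf)) volume 0 β := fun z y =>
    ((hNli z y).div_const Dinf).continuousOn_mul (hKcont z y).continuousOn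
  have hdi : ∀ M z y, IntervalIntegrable (fun u => K z y u * d M z y u) volume 0 β := fun M z y =>
    ((hfi M z y).sub (hgi z y)).congr fun u _ => by simp only [hd]; ring
  have hdni : ∀ M z y, IntervalIntegrable (fun u => ‖d M z y u‖) volume 0 β := fun M z y =>
    ((((hWc M z y).div_const (D M)).intervalIntegrable 0 β).sub ((hNli z y).div_const Dinf)).norm.congr fun u _ => by
      simp only [hd]
  have hFi : ∀ M, IntervalIntegrable (fun u => ∑ z : TorusSite 2 L, ∑ y : TorusSite 2 L, K z y u * (W M z y u / D M)) volume 0 β :=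
    fun M => (continuous_finsetSum _ fun z _ => continuous_finsetSum _ fun y _ =>
      (hKcont z y).mul ((hWc M z y).div_const _)).intervalIntegrable _ _
  have hGi : IntervalIntegrable (fun u => ∑ z : TorusSite 2 L, ∑ y : TorusSite 2 L, K z y u * (Nl z y u / Dinf)) volume 0 β := by
    have h := IntervalIntegrable.sum (Finset.univ : Finset (TorusSite 2 L)) fun z _ =>
      IntervalIntegrable.sum (Finset.univ : Finset (TorusSite 2 L)) fun y _ => hgi z y
    simpa only [Finset.sum_fn] using h
  have hdSi : ∀ M, IntervalIntegrable (fun u => ∑ z : TorusSite 2 L, ∑ y : TorusSite 2 L, K z y u * d M z y u) volume 0 β := by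
    intro M
    have h := IntervalIntegrable.sum (Finset.univ : Finset (TorusSite 2 L)) fun z _ =>
      IntervalIntegrable.sum (Finset.univ : Finset (TorusSite 2 L)) fun y _ => hdi M z y
    simpa only [Finset.sum_fn] using h
  have hdnSi : ∀ M, IntervalIntegrable (fun u => ∑ z : TorusSite 2 L, ∑ y : TorusSite 2 L, ‖d M z y u‖) volume 0 β := by
    intro M
    have h := IntervalIntegrable.sum (Finset.univ : Finset (TorusSite 2 L)) fun z _ =>
      IntervalIntegrable.sum (Finset.univ : Finset (TorusSite 2 L)) fun y _ => hdni M z y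
    simpa only [Finset.sum_fn] using h
  have hdnyi : ∀ M z, IntervalIntegrable (fun u => ∑ y : TorusSite 2 L, ‖d M z y u‖) volume 0 β := by
    intro M z
    have h := IntervalIntegrable.sum (Finset.univ : Finset (TorusSite 2 L)) fun y _ => hdni M z y
    simpa only [Finset.sum_fn] using h
  -- the difference of the transforms is the transform of the differences
  have hdiff : ∀ M : ℕ, (∫ u in (0 : ℝ)..β, ∑ z : TorusSite 2 L, ∑ y : TorusSite 2 L, K z y u * (W M z y u / D M)) -
      (∫ u in (0 : ℝ)..β, ∑ z : TorusSite 2 L, ∑ y : TorusSite 2 L, K z y u * (Nl z y u / Dinf)) =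
      ∫ u in (0 : ℝ)..β, ∑ z : TorusSite 2 L, ∑ y : TorusSite 2 L, K z y u * d M z y u := by
    intro M
    rw [← intervalIntegral.integral_sub (hFi M) hGi]
    congr 1
    funext u
    rw [← Finset.sum_sub_distrib]
    refine Finset.sum_congr rfl fun z _ => ?_
    rw [← Finset.sum_sub_distrib]
    refine Finset.sum_congr rfl fun y _ => ?_
    rw [hd]
    ring
  -- norm estimate: `‖∫ Σ K d‖ ≤ Σ_{z,y} ∫_{[0,β]} ‖d‖`
  have hest : ∀ M : ℕ, ‖∫ u in (0 : ℝ)..β, ∑ z : TorusSite 2 L, ∑ y : TorusSite 2 L, K z y u * d M z y u‖ ≤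
      ∑ z : TorusSite 2 L, ∑ y : TorusSite 2 L, ∫ u in Set.Icc (0 : ℝ) β, ‖d M z y u‖ := by
    intro M
    have h1 : ‖∫ u in (0 : ℝ)..β, ∑ z : TorusSite 2 L, ∑ y : TorusSite 2 L, K z y u * d M z y u‖ ≤
        ∫ u in (0 : ℝ)..β, ‖∑ z : TorusSite 2 L, ∑ y : TorusSite 2 L, K z y u * d M z y u‖ :=
      intervalIntegral.norm_integral_le_integral_norm hβ.le
    have h2 : (∫ u in (0 : ℝ)..β, ‖∑ z : TorusSite 2 L, ∑ y : TorusSite 2 L, K z y u * d M z y u‖) ≤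
        ∫ u in (0 : ℝ)..β, ∑ z : TorusSite 2 L, ∑ y : TorusSite 2 L, ‖d M z y u‖ := by
      refine intervalIntegral.integral_mono_on hβ.le (hdSi M).norm (hdnSi M) fun u _ => ?_
      refine (norm_sum_le _ _).trans (Finset.sum_le_sum fun z _ => (norm_sum_le _ _).trans (Finset.sum_le_sum fun y _ => ?_))
      rw [norm_mul, hKnorm, one_mul]
    have h3 : (∫ u in (0 : ℝ)..β, ∑ z : TorusSite 2 L, ∑ y : TorusSite 2 L, ‖d M z y u‖) =
        ∑ z : TorusSite 2 L, ∑ y : TorusSite 2 L, ∫ u in Set.Icc (0 : ℝ) β, ‖d M z y u‖ := by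
      rw [intervalIntegral.integral_finsetSum fun z _ => hdnyi M z]
      refine Finset.sum_congr rfl fun z _ => ?_
      rw [intervalIntegral.integral_finsetSum fun y _ => hdni M z y]
      refine Finset.sum_congr rfl fun y _ => ?_
      rw [intervalIntegral.integral_of_le hβ.le, integral_Icc_eq_integral_Ioc]
    exact h1.trans (h2.trans h3.le)
  -- conclude
  have hsum0 : Tendsto (fun M : ℕ => ∑ z : TorusSite 2 L, ∑ y : TorusSite 2 L, ∫ u in Set.Icc (0 : ℝ) β, ‖d M z y u‖) atTop (𝓝 0) := by
    have h := tendsto_finsetSum (Finset.univ : Finset (TorusSite 2 L)) fun z _ =>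
      tendsto_finsetSum (Finset.univ : Finset (TorusSite 2 L)) fun y _ => hdL1 z y
    simpa only [Finset.sum_const_zero] using h
  rw [tendsto_iff_norm_sub_tendsto_zero]
  refine squeeze_zero (fun M => norm_nonneg _) (fun M => ?_) hsum0
  rw [hdiff M]
  exact hest M

/-! ## §4 The label form: the momentum two-point ratio and the bare carrier at a kept index of integer `n` -/

/-- At cutoff `M`, for a kept index `ω` with `matsubaraInt M ω = n` (so `ω`'s frequency is `k₀ = (2n+1)π/β`):
`N_M((ω,p),σ)/D_M = β·∫₀^β Σ_{z,y} e^{−ik₀u} conj χ_p(z) χ_p(y) · W_M(z,y,u)/D_M du`. -/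
theorem genPairRatio_eq_transform {M : ℕ} {β : ℝ} (hβ : 0 < β) (U μ : ℝ) (σ : Fin 2) {n : ℤ} (ω : MatsubaraIdx M)
    (hω : matsubaraInt M ω = n) (p : TorusSite 2 L) :
    gaussExpect ℂ (hubbardCovariance L M β μ 0)
          (gen ℂ ((((ω, p), σ), 0) : HubbardFieldIdx L M) * gen ℂ ((((ω, p), σ), 1) : HubbardFieldIdx L M) *
            grassmannExp (-(hubbardInteraction L M β U))) /
        effPartitionFn ℂ (hubbardCovariance L M β μ 0) (hubbardInteraction L M β U) =
      (β : ℂ) * ∫ u in (0 : ℝ)..β, ∑ z : TorusSite 2 L, ∑ y : TorusSite 2 L,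
        Complex.exp (-(((fermiMatsubara β n * u : ℝ) : ℂ) * Complex.I)) * conj (torusChar p z) * torusChar p y *
          (gaussExpect ℂ (hubbardCovariance L M β μ 0)
              (positionField L M β 0 σ z u * positionField L M β 1 σ y 0 * grassmannExp (-(hubbardInteraction L M β U))) /
            effPartitionFn ℂ (hubbardCovariance L M β μ 0) (hubbardInteraction L M β U)) := by
  rw [genPair_eq_integral_twoPointWord_two hβ U μ σ (ω, p), mul_div_assoc]
  congr 1
  rw [← intervalIntegral.integral_div]
  congr 1
  funext u
  rw [Finset.sum_div]
  refine Finset.sum_congr rfl fun z _ => ?_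
  rw [Finset.sum_div]
  refine Finset.sum_congr rfl fun y _ => ?_
  rw [show matsubaraFreq β M ω = fermiMatsubara β n by rw [← hω]; rfl]
  ring

/-- At cutoff `M` with `D_M ≠ 0`, for a kept index `ω` of integer `n`, the BARE carrier is the frame-reduced affine image of the transform:
`Σ̂⁰_{L,M}((ω,p),σ) = (β·I_M + βL²ĝ)/(βL²ĝ²)`, `ĝ = 1/(−ik₀ + ε(p) − μ)`, `I_M` the transform of `W_M/D_M`. -/
theorem klSelfEnergy_bare_eq_transform {M : ℕ} {β : ℝ} (hβ : 0 < β) (U μ : ℝ) (σ : Fin 2) {n : ℤ} (ω : MatsubaraIdx M)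
    (hω : matsubaraInt M ω = n) (p : TorusSite 2 L)
    (hD : effPartitionFn ℂ (hubbardCovariance L M β μ 0) (hubbardInteraction L M β U) ≠ 0) :
    klSelfEnergy L M β U μ 0 klE0 (nScales β + 1) (ω, p) σ =
      ((β : ℂ) * (∫ u in (0 : ℝ)..β, ∑ z : TorusSite 2 L, ∑ y : TorusSite 2 L,
          Complex.exp (-(((fermiMatsubara β n * u : ℝ) : ℂ) * Complex.I)) * conj (torusChar p z) * torusChar p y *
            (gaussExpect ℂ (hubbardCovariance L M β μ 0)
                (positionField L M β 0 σ z u * positionField L M β 1 σ y 0 * grassmannExp (-(hubbardInteraction L M β U))) /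
              effPartitionFn ℂ (hubbardCovariance L M β μ 0) (hubbardInteraction L M β U))) +
          ((β * (L : ℝ) ^ 2 : ℝ) : ℂ) * (1 / (-Complex.I * ((fermiMatsubara β n : ℝ) : ℂ) + ((nambuXi L μ p : ℝ) : ℂ)))) /
        (((β * (L : ℝ) ^ 2 : ℝ) : ℂ) * (1 / (-Complex.I * ((fermiMatsubara β n : ℝ) : ℂ) + ((nambuXi L μ p : ℝ) : ℂ))) ^ 2) := by
  have hred := klSelfEnergy_nScales_succ_frame_reduction hβ U μ 0 (ω, p) σ hD
  have hprop : propCT L M β μ 0 (ω, p) = 1 / (-Complex.I * ((fermiMatsubara β n : ℝ) : ℂ) + ((nambuXi L μ p : ℝ) : ℂ)) := by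
    rw [propCT, nambuXiCT_zero_frame, show matsubaraFreq β M (ω, p).1 = fermiMatsubara β n by rw [← hω]; rfl]
  rw [hprop, genPairRatio_eq_transform hβ U μ σ ω hω p] at hred
  have hβL : ((β * (L : ℝ) ^ 2 : ℝ) : ℂ) ≠ 0 := by
    have hL : (L : ℝ) ≠ 0 := by exact_mod_cast NeZero.ne L
    exact_mod_cast mul_ne_zero hβ.ne' (pow_ne_zero 2 hL)
  have hg : (1 / (-Complex.I * ((fermiMatsubara β n : ℝ) : ℂ) + ((nambuXi L μ p : ℝ) : ℂ))) ≠ 0 := by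
    rw [← hprop]; exact propCT_ne_zero (L := L) (M := M) hβ.ne' μ 0 (ω, p)
  rw [eq_div_iff (mul_ne_zero hβL (pow_ne_zero 2 hg)), ← hred]
  ring

/-! ## §5 The per-label limit of the bare carrier -/

/-- **THE PER-LABEL LIMIT OF THE BARE CARRIER FROM THE TIME-RESOLVED TWO-POINT LIMIT** (every `U`, `L ≥ 3`, `β > 0`): if
`W_M(x,y,u) → Nl x y u` for all sites and all `u ∈ (0,β)`, then for every Matsubara integer `n` and torus momentum `p`, with
`I∞ = ∫₀^β Σ_{z,y} e^{−ik₀u} conj χ_p(z) χ_p(y)·Nl z y u/D∞ du`, `ĝ = 1/(−ik₀ + ε(p) − μ)` and `σ∞ = (β·I∞ + βL²ĝ)/(βL²ĝ²)`: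
`∀ ε > 0, ∃ M₁, ∀ M ≥ M₁, ∀ ω, matsubaraInt M ω = n → ‖klSelfEnergy L M β U μ 0 klE0 (nScales β + 1) (ω, p) σ − σ∞‖ ≤ ε` — the shape of
hypothesis `h2` of `stub_vl_bound_of_Z1_twoPoint`. -/
theorem twoPointLabelLimit_of_timeLimit (hL : 3 ≤ L) {β : ℝ} (hβ : 0 < β) (U μ : ℝ) (σ : Fin 2)
    {Nl : TorusSite 2 L → TorusSite 2 L → ℝ → ℂ}
    (hNl : ∀ (x y : TorusSite 2 L), ∀ u ∈ Set.Ioo (0 : ℝ) β, Tendsto (fun M : ℕ => gaussExpect ℂ (hubbardCovariance L M β μ 0)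
        (positionField L M β 0 σ x u * positionField L M β 1 σ y 0 * grassmannExp (-(hubbardInteraction L M β U))))
      atTop (𝓝 (Nl x y u)))
    (n : ℤ) (p : TorusSite 2 L) :
    ∀ ε : ℝ, 0 < ε → ∃ M₁ : ℕ, ∀ M : ℕ, M₁ ≤ M → ∀ ω : MatsubaraIdx M, matsubaraInt M ω = n →
      ‖klSelfEnergy L M β U μ 0 klE0 (nScales β + 1) (ω, p) σ -
          ((β : ℂ) * (∫ u in (0 : ℝ)..β, ∑ z : TorusSite 2 L, ∑ y : TorusSite 2 L,
              Complex.exp (-(((fermiMatsubara β n * u : ℝ) : ℂ) * Complex.I)) * conj (torusChar p z) * torusChar p y *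
                (Nl z y u / ((Real.exp (-(β * U / 4 * (L : ℝ) ^ 2)) : ℂ) *
                    Matrix.partitionFn β (hubbardTorusWith 2 L 1 U (μ + U / 2)) / Matrix.partitionFn β (hubbardTorusWith 2 L 1 0 μ)))) +
              ((β * (L : ℝ) ^ 2 : ℝ) : ℂ) * (1 / (-Complex.I * ((fermiMatsubara β n : ℝ) : ℂ) + ((nambuXi L μ p : ℝ) : ℂ)))) /
            (((β * (L : ℝ) ^ 2 : ℝ) : ℂ) * (1 / (-Complex.I * ((fermiMatsubara β n : ℝ) : ℂ) + ((nambuXi L μ p : ℝ) : ℂ))) ^ 2)‖ ≤ ε := by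
  intro ε hε
  set c : ℂ := ((β * (L : ℝ) ^ 2 : ℝ) : ℂ) with hc
  set g : ℂ := 1 / (-Complex.I * ((fermiMatsubara β n : ℝ) : ℂ) + ((nambuXi L μ p : ℝ) : ℂ)) with hg
  -- the affine image of the converging transforms converges
  set Φ : ℂ → ℂ := fun t => ((β : ℂ) * t + c * g) / (c * g ^ 2) with hΦ
  have hΦc : Continuous Φ := by simp only [hΦ]; fun_prop
  have hT := (hΦc.tendsto _).comp (tendsto_twoPointTransform hL hβ U μ σ n p hNl)
  have hev := (Metric.tendsto_nhds.mp hT) ε hε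
  obtain ⟨M₁, hM₁⟩ := eventually_atTop.mp (hev.and (eventually_effPartitionFn_ne_zero hL hβ U μ))
  refine ⟨M₁, fun M hM ω hω => ?_⟩
  obtain ⟨hdist, hD⟩ := hM₁ M hM
  rw [klSelfEnergy_bare_eq_transform hβ U μ σ ω hω p hD]
  rw [dist_eq_norm] at hdist
  simpa only [hΦ, Function.comp_apply, hc, hg] using hdist.le

end Summit.HubbardSuperconductivity.HubbardSuperconductivity.Theorems.TwoPointAssembly

end
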